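import Summits.QuantumFields.YangMills.Theorems.AllWindowsColdBoxBoxHighLineSmearedFPParityLink
import Mathlib
import HarnessLib

/-!
# TASK T-S5/U5 step (1b), brick T-S5.4e (part 2/2, DIVERGENCE AND `landauPhi` LEVEL): the orbit expansion of `landauPhi` with an EXACT PARITY SPLIT (planner ym-idea-2 g17,
# routing 2026-08-29T17:30:23Z (a), shape confirmed 17:31:40Z) — LINE-19 ⟨stmt-QuantumFields-24004⟩/⟨24335⟩, LINE-20 ⟨24336⟩

Free-hands work of width seat `ym-line-sfw-p2-w3` (g39, cell `ym-idea-1`), over w2 g30's ✓p735122 `…SmearedFPOperator` (`pauliLinkLin`,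
`divDefectLin`, `extPauli`, `fpOperator_mulVec`).  Along the gauge orbit `a ↦ U^{exp i a}` (`a : ℤ⁴ → ℝ³` a site field, `(exp ia)_z = expPauli (a z)`)
every transformed link splits EXACTLY into an even and an odd part under `a ↦ −a`:

  `(U^{exp ia})_e = e^{X₋} U_e e^{−X₊} = linkEven + linkOdd`,  `linkEven = c₋c₊·U_e − s₋s₊·X₋U_eX₊`,  `linkOdd = s₋c₊·X₋U_e − c₋s₊·U_eX₊`

(`X_z = su2Coord (a z)`, `c_z = cos|a_z|`, `s_z = sinc|a_z|`, ✓`exp_su2Coord`, ✓`coe_inv_expPauli`), hence `divDefect (U^{exp ia}) x = divEven + divOdd`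
and **`landauPhi H (U^{exp ia}) = phiEven + phiOdd`** with `phiEven = Σ(divEven² + divOdd²)` EVEN and `phiOdd = 2Σ divEven·divOdd` ODD — no Taylor
expansion in the split itself.  QUANTITATIVE part (per site, absolute constants, fields with `|a_z| ≤ 1` near the site): with `m` dominating `|a|` on the
nine sites `x, x ± e_μ`,

* `|divOdd U a x c − divDefectLin U a x c| ≤ 160·m³` (the odd part is the LINEAR term up to a cubic error) and `|divEven U a x c − divDefect U x c| ≤ 112·m²`;
* at a LANDAU REPRESENTATIVE (`divDefect U x = 0`): `|divEven² + divOdd² − divDefectLin²| ≤ 44608·m⁴` and `|2·divEven·divOdd| ≤ K₃·m²·(|divDefectLin| + m³)`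
  per site and colour, which sum to the per-site bounds the Laplace assembly consumes (`phiEven` vs `‖fpOperator H U *ᵥ A‖²` for 4a/4g/4k, `T := β·phiOdd`
  for ✓4h `oddPerturbationBounds`).

Mathlib + tree only; no `sorry`.  HONEST LABEL: one brick of step (1b) of the XL stubs S5/U5; T-S5.4 proper, S5, U5, ⟨24004⟩ ⟨24335⟩ ⟨24336⟩ remain OPEN; no
crux, rung or summit is proved; the Yang–Mills mass gap is NOT proved by this file.
-/

set_option autoImplicit false

noncomputable section

open Matrix Finset
open scoped Matrix.Norms.Operator
open Literature.MathematicalPhysics.QuantumFieldTheory.Balaban1983to89.B10Eq18SigmaSU2 (su2Coord)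
open Literature.MathematicalPhysics.QuantumFieldTheory.Balaban1983to89.B10Eq18SigmaSU2Haar (expPauli coe_expPauli exp_su2Coord expPauli_zero)
open Literature.MathematicalPhysics.QuantumLattice (LGConfig ZdEdge gaugeTransformZd)
open Literature.Probability.LatticeModels (Site)

namespace Summit.QuantumFields.YangMills.Theorems.AllWindowsColdBoxBoxHighLine

namespace Parity

/-! ## The split of the divergence defect along the orbit -/

/-- The even part of the link `e` of `U^{exp ia}`. [problem-side definition] -/
def linkEvenAt (U : LGConfig 4 SU2) (a : Site 4 → EuclideanSpace ℝ (Fin 3)) (e : ZdEdge 4) : Matrix (Fin 2) (Fin 2) ℂ :=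
  linkEven (U e : Matrix (Fin 2) (Fin 2) ℂ) (a e.1) (a (e.1 + Pi.single e.2 1))

/-- The odd part of the link `e` of `U^{exp ia}`. [problem-side definition] -/
def linkOddAt (U : LGConfig 4 SU2) (a : Site 4 → EuclideanSpace ℝ (Fin 3)) (e : ZdEdge 4) : Matrix (Fin 2) (Fin 2) ℂ :=
  linkOdd (U e : Matrix (Fin 2) (Fin 2) ℂ) (a e.1) (a (e.1 + Pi.single e.2 1))

/-- **The transformed link, as a matrix, is `linkEvenAt + linkOddAt`.** -/
theorem coe_gaugeTransformZd_expPauli (U : LGConfig 4 SU2) (a : Site 4 → EuclideanSpace ℝ (Fin 3)) (e : ZdEdge 4) :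
    ((gaugeTransformZd (fun z => expPauli (a z)) U e : SU2) : Matrix (Fin 2) (Fin 2) ℂ) = linkEvenAt U a e + linkOddAt U a e := by
  unfold gaugeTransformZd linkEvenAt linkOddAt
  rw [Submonoid.coe_mul, Submonoid.coe_mul]
  exact coe_expPauli_mul_mul_inv _ _ _

/-- EVEN part of `divDefect (U^{exp ia}) x`. [problem-side definition] -/
def divEven (U : LGConfig 4 SU2) (a : Site 4 → EuclideanSpace ℝ (Fin 3)) (x : Site 4) : Fin 3 → ℝ :=
  ∑ μ : Fin 4, (imVecM (linkEvenAt U a (x - Pi.single μ 1, μ)) - imVecM (linkEvenAt U a (x, μ)))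

/-- ODD part of `divDefect (U^{exp ia}) x`. [problem-side definition] -/
def divOdd (U : LGConfig 4 SU2) (a : Site 4 → EuclideanSpace ℝ (Fin 3)) (x : Site 4) : Fin 3 → ℝ :=
  ∑ μ : Fin 4, (imVecM (linkOddAt U a (x - Pi.single μ 1, μ)) - imVecM (linkOddAt U a (x, μ)))

/-- Componentwise formula for `divEven`. -/
theorem divEven_apply (U : LGConfig 4 SU2) (a : Site 4 → EuclideanSpace ℝ (Fin 3)) (x : Site 4) (c : Fin 3) :
    divEven U a x c = ∑ μ : Fin 4, (imVecM (linkEvenAt U a (x - Pi.single μ 1, μ)) c - imVecM (linkEvenAt U a (x, μ)) c) := by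
  simp only [divEven, Finset.sum_apply, Pi.sub_apply]

/-- Componentwise formula for `divOdd`. -/
theorem divOdd_apply (U : LGConfig 4 SU2) (a : Site 4 → EuclideanSpace ℝ (Fin 3)) (x : Site 4) (c : Fin 3) :
    divOdd U a x c = ∑ μ : Fin 4, (imVecM (linkOddAt U a (x - Pi.single μ 1, μ)) c - imVecM (linkOddAt U a (x, μ)) c) := by
  simp only [divOdd, Finset.sum_apply, Pi.sub_apply]

/-- **`divDefect (U^{exp ia}) x = divEven + divOdd`** (exact). -/
theorem divDefect_gaugeTransformZd_eq (U : LGConfig 4 SU2) (a : Site 4 → EuclideanSpace ℝ (Fin 3)) (x : Site 4) :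
    divDefect (gaugeTransformZd (fun z => expPauli (a z)) U) x = divEven U a x + divOdd U a x := by
  unfold divDefect divEven divOdd
  rw [← Finset.sum_add_distrib]
  refine Finset.sum_congr rfl fun μ _ => ?_
  rw [imVec_eq_imVecM, imVec_eq_imVecM, coe_gaugeTransformZd_expPauli, coe_gaugeTransformZd_expPauli, imVecM_add, imVecM_add]
  abel

/-- `imVecM (−X) = −imVecM X`. -/
theorem imVecM_neg (X : Matrix (Fin 2) (Fin 2) ℂ) : imVecM (-X) = -imVecM X := by
  have h := imVecM_sub 0 X
  rwa [zero_sub, imVecM_zero, zero_sub] at h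

/-- The even part is even in the field. -/
theorem divEven_neg (U : LGConfig 4 SU2) (a : Site 4 → EuclideanSpace ℝ (Fin 3)) (x : Site 4) : divEven U (-a) x = divEven U a x := by
  simp only [divEven, linkEvenAt, Pi.neg_apply, linkEven_neg]

/-- The odd part is odd in the field. -/
theorem divOdd_neg (U : LGConfig 4 SU2) (a : Site 4 → EuclideanSpace ℝ (Fin 3)) (x : Site 4) : divOdd U (-a) x = -divOdd U a x := by
  simp only [divOdd, linkOddAt, Pi.neg_apply, linkOdd_neg, imVecM_neg, ← Finset.sum_neg_distrib, neg_sub', sub_neg_eq_add]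

/-! ## Per-site bounds (`m` dominates `|a|` on the nine sites `x, x ± e_μ`, `m ≤ 1`) -/

section SiteBounds

variable {U : LGConfig 4 SU2} {a : Site 4 → EuclideanSpace ℝ (Fin 3)} {x : Site 4} {m : ℝ}

/-- **The odd part of the divergence defect is its linearisation up to a cubic error**: `|divOdd − divDefectLin| ≤ 72m³`. -/
theorem abs_divOdd_sub_divDefectLin_le (hx : ‖a x‖ ≤ m)
    (hnb : ∀ μ : Fin 4, ‖a (x - Pi.single μ 1)‖ ≤ m ∧ ‖a (x + Pi.single μ 1)‖ ≤ m) (hm : m ≤ 1) (c : Fin 3) :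
    |divOdd U a x c - divDefectLin U a x c| ≤ 72 * m ^ 3 := by
  rw [divOdd_apply, divDefectLin_apply, ← Finset.sum_sub_distrib]
  have hterm : ∀ μ : Fin 4,
      |imVecM (linkOddAt U a (x - Pi.single μ 1, μ)) c - imVecM (linkOddAt U a (x, μ)) c
        - (imVecM (pauliLinkLin U a (x - Pi.single μ 1, μ)) c - imVecM (pauliLinkLin U a (x, μ)) c)| ≤ 9 * m ^ 3 + 9 * m ^ 3 := by
    intro μ
    have h1 : imVecM (linkOddAt U a (x - Pi.single μ 1, μ)) c - imVecM (pauliLinkLin U a (x - Pi.single μ 1, μ)) c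
        = imVecM (linkOddAt U a (x - Pi.single μ 1, μ) - pauliLinkLin U a (x - Pi.single μ 1, μ)) c := by
      rw [imVecM_sub]; rfl
    have h2 : imVecM (linkOddAt U a (x, μ)) c - imVecM (pauliLinkLin U a (x, μ)) c
        = imVecM (linkOddAt U a (x, μ) - pauliLinkLin U a (x, μ)) c := by
      rw [imVecM_sub]; rfl
    have e1 : |imVecM (linkOddAt U a (x - Pi.single μ 1, μ) - pauliLinkLin U a (x - Pi.single μ 1, μ)) c| ≤ 9 * m ^ 3 := by
      refine (abs_imVecM_le_norm _ c).trans ?_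
      have hq : ‖a ((x - Pi.single μ 1) + Pi.single μ 1)‖ ≤ m := by rw [sub_add_cancel]; exact hx
      exact norm_linkOdd_sub_lin_le (norm_coe_le_two _) (hnb μ).1 hq hm
    have e2 : |imVecM (linkOddAt U a (x, μ) - pauliLinkLin U a (x, μ)) c| ≤ 9 * m ^ 3 := by
      refine (abs_imVecM_le_norm _ c).trans ?_
      exact norm_linkOdd_sub_lin_le (norm_coe_le_two _) hx (hnb μ).2 hm
    calc |imVecM (linkOddAt U a (x - Pi.single μ 1, μ)) c - imVecM (linkOddAt U a (x, μ)) c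
          - (imVecM (pauliLinkLin U a (x - Pi.single μ 1, μ)) c - imVecM (pauliLinkLin U a (x, μ)) c)|
        = |(imVecM (linkOddAt U a (x - Pi.single μ 1, μ)) c - imVecM (pauliLinkLin U a (x - Pi.single μ 1, μ)) c)
            - (imVecM (linkOddAt U a (x, μ)) c - imVecM (pauliLinkLin U a (x, μ)) c)| := by ring_nf
      _ ≤ |imVecM (linkOddAt U a (x - Pi.single μ 1, μ)) c - imVecM (pauliLinkLin U a (x - Pi.single μ 1, μ)) c|
            + |imVecM (linkOddAt U a (x, μ)) c - imVecM (pauliLinkLin U a (x, μ)) c| := abs_sub _ _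
      _ ≤ 9 * m ^ 3 + 9 * m ^ 3 := by rw [h1, h2]; exact add_le_add e1 e2
  calc |∑ μ : Fin 4, (imVecM (linkOddAt U a (x - Pi.single μ 1, μ)) c - imVecM (linkOddAt U a (x, μ)) c
          - (imVecM (pauliLinkLin U a (x - Pi.single μ 1, μ)) c - imVecM (pauliLinkLin U a (x, μ)) c))|
      ≤ ∑ μ : Fin 4, |imVecM (linkOddAt U a (x - Pi.single μ 1, μ)) c - imVecM (linkOddAt U a (x, μ)) c
          - (imVecM (pauliLinkLin U a (x - Pi.single μ 1, μ)) c - imVecM (pauliLinkLin U a (x, μ)) c)| :=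
        Finset.abs_sum_le_sum_abs _ _
    _ ≤ ∑ _μ : Fin 4, (9 * m ^ 3 + 9 * m ^ 3) := Finset.sum_le_sum fun μ _ => hterm μ
    _ = 72 * m ^ 3 := by simp; ring

/-- **The even part of the divergence defect is the untransformed defect up to a quadratic error**: `|divEven − divDefect U| ≤ 160m²`. -/
theorem abs_divEven_sub_divDefect_le (hx : ‖a x‖ ≤ m)
    (hnb : ∀ μ : Fin 4, ‖a (x - Pi.single μ 1)‖ ≤ m ∧ ‖a (x + Pi.single μ 1)‖ ≤ m) (c : Fin 3) :
    |divEven U a x c - divDefect U x c| ≤ 160 * m ^ 2 := by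
  rw [divEven_apply, divDefect_apply, ← Finset.sum_sub_distrib]
  have hterm : ∀ μ : Fin 4,
      |imVecM (linkEvenAt U a (x - Pi.single μ 1, μ)) c - imVecM (linkEvenAt U a (x, μ)) c
        - (imVec (U (x - Pi.single μ 1, μ)) c - imVec (U (x, μ)) c)| ≤ 20 * m ^ 2 + 20 * m ^ 2 := by
    intro μ
    rw [imVec_eq_imVecM, imVec_eq_imVecM]
    have h1 : imVecM (linkEvenAt U a (x - Pi.single μ 1, μ)) c - imVecM ((U (x - Pi.single μ 1, μ) : Matrix (Fin 2) (Fin 2) ℂ)) c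
        = imVecM (linkEvenAt U a (x - Pi.single μ 1, μ) - (U (x - Pi.single μ 1, μ) : Matrix (Fin 2) (Fin 2) ℂ)) c := by
      rw [imVecM_sub]; rfl
    have h2 : imVecM (linkEvenAt U a (x, μ)) c - imVecM ((U (x, μ) : Matrix (Fin 2) (Fin 2) ℂ)) c
        = imVecM (linkEvenAt U a (x, μ) - (U (x, μ) : Matrix (Fin 2) (Fin 2) ℂ)) c := by
      rw [imVecM_sub]; rfl
    have e1 : |imVecM (linkEvenAt U a (x - Pi.single μ 1, μ) - (U (x - Pi.single μ 1, μ) : Matrix (Fin 2) (Fin 2) ℂ)) c|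
        ≤ 20 * m ^ 2 := by
      refine (abs_imVecM_le_norm _ c).trans ?_
      have hq : ‖a ((x - Pi.single μ 1) + Pi.single μ 1)‖ ≤ m := by rw [sub_add_cancel]; exact hx
      exact norm_linkEven_sub_le (norm_coe_le_two _) (hnb μ).1 hq
    have e2 : |imVecM (linkEvenAt U a (x, μ) - (U (x, μ) : Matrix (Fin 2) (Fin 2) ℂ)) c| ≤ 20 * m ^ 2 := by
      refine (abs_imVecM_le_norm _ c).trans ?_
      exact norm_linkEven_sub_le (norm_coe_le_two _) hx (hnb μ).2
    calc |imVecM (linkEvenAt U a (x - Pi.single μ 1, μ)) c - imVecM (linkEvenAt U a (x, μ)) c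
          - (imVecM ((U (x - Pi.single μ 1, μ) : Matrix (Fin 2) (Fin 2) ℂ)) c - imVecM ((U (x, μ) : Matrix (Fin 2) (Fin 2) ℂ)) c)|
        = |(imVecM (linkEvenAt U a (x - Pi.single μ 1, μ)) c - imVecM ((U (x - Pi.single μ 1, μ) : Matrix (Fin 2) (Fin 2) ℂ)) c)
            - (imVecM (linkEvenAt U a (x, μ)) c - imVecM ((U (x, μ) : Matrix (Fin 2) (Fin 2) ℂ)) c)| := by ring_nf
      _ ≤ |imVecM (linkEvenAt U a (x - Pi.single μ 1, μ)) c - imVecM ((U (x - Pi.single μ 1, μ) : Matrix (Fin 2) (Fin 2) ℂ)) c|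
            + |imVecM (linkEvenAt U a (x, μ)) c - imVecM ((U (x, μ) : Matrix (Fin 2) (Fin 2) ℂ)) c| := abs_sub _ _
      _ ≤ 20 * m ^ 2 + 20 * m ^ 2 := by rw [h1, h2]; exact add_le_add e1 e2
  calc |∑ μ : Fin 4, (imVecM (linkEvenAt U a (x - Pi.single μ 1, μ)) c - imVecM (linkEvenAt U a (x, μ)) c
          - (imVec (U (x - Pi.single μ 1, μ)) c - imVec (U (x, μ)) c))|
      ≤ ∑ μ : Fin 4, |imVecM (linkEvenAt U a (x - Pi.single μ 1, μ)) c - imVecM (linkEvenAt U a (x, μ)) c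
          - (imVec (U (x - Pi.single μ 1, μ)) c - imVec (U (x, μ)) c)| := Finset.abs_sum_le_sum_abs _ _
    _ ≤ ∑ _μ : Fin 4, (20 * m ^ 2 + 20 * m ^ 2) := Finset.sum_le_sum fun μ _ => hterm μ
    _ = 160 * m ^ 2 := by simp; ring

/-- The linearised divergence defect is `O(m)`: `|divDefectLin U a x c| ≤ 96m`. -/
theorem abs_divDefectLin_le (hx : ‖a x‖ ≤ m)
    (hnb : ∀ μ : Fin 4, ‖a (x - Pi.single μ 1)‖ ≤ m ∧ ‖a (x + Pi.single μ 1)‖ ≤ m) (c : Fin 3) :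
    |divDefectLin U a x c| ≤ 96 * m := by
  rw [divDefectLin_apply]
  have hterm : ∀ μ : Fin 4, |imVecM (pauliLinkLin U a (x - Pi.single μ 1, μ)) c - imVecM (pauliLinkLin U a (x, μ)) c| ≤ 12 * m + 12 * m := by
    intro μ
    refine (abs_sub _ _).trans (add_le_add ?_ ?_)
    · refine (abs_imVecM_le_norm _ c).trans ?_
      have hq : ‖a ((x - Pi.single μ 1) + Pi.single μ 1)‖ ≤ m := by rw [sub_add_cancel]; exact hx
      exact norm_lin_le (norm_coe_le_two _) (hnb μ).1 hq
    · exact (abs_imVecM_le_norm _ c).trans (norm_lin_le (norm_coe_le_two _) hx (hnb μ).2)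
  calc |∑ μ : Fin 4, (imVecM (pauliLinkLin U a (x - Pi.single μ 1, μ)) c - imVecM (pauliLinkLin U a (x, μ)) c)|
      ≤ ∑ μ : Fin 4, |imVecM (pauliLinkLin U a (x - Pi.single μ 1, μ)) c - imVecM (pauliLinkLin U a (x, μ)) c| :=
        Finset.abs_sum_le_sum_abs _ _
    _ ≤ ∑ _μ : Fin 4, (12 * m + 12 * m) := Finset.sum_le_sum fun μ _ => hterm μ
    _ = 96 * m := by simp; ring

/-- **At a Landau representative** (`divDefect U x = 0`): the per-site, per-colour EVEN error
`|divEven² + divOdd² − divDefectLin²| ≤ 44608·m⁴`. -/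
theorem abs_even_sq_add_odd_sq_sub_lin_sq_le (hL : divDefect U x = 0) (hx : ‖a x‖ ≤ m)
    (hnb : ∀ μ : Fin 4, ‖a (x - Pi.single μ 1)‖ ≤ m ∧ ‖a (x + Pi.single μ 1)‖ ≤ m) (hm : m ≤ 1) (c : Fin 3) :
    |divEven U a x c ^ 2 + divOdd U a x c ^ 2 - divDefectLin U a x c ^ 2| ≤ 44608 * m ^ 4 := by
  have hm0 : 0 ≤ m := (norm_nonneg _).trans hx
  have hE := abs_divEven_sub_divDefect_le (U := U) hx hnb c
  rw [hL, Pi.zero_apply, sub_zero] at hE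
  have hO := abs_divOdd_sub_divDefectLin_le (U := U) hx hnb hm c
  have hLin := abs_divDefectLin_le (U := U) hx hnb c
  set E := divEven U a x c
  set O := divOdd U a x c
  set L := divDefectLin U a x c
  have h1 : |E ^ 2| ≤ (160 * m ^ 2) ^ 2 := by
    rw [abs_pow]; exact pow_le_pow_left₀ (abs_nonneg _) hE 2
  have h2 : |O ^ 2 - L ^ 2| ≤ 72 * m ^ 3 * (2 * (96 * m) + 72 * m ^ 3) := by
    have e : O ^ 2 - L ^ 2 = (O - L) * ((O - L) + 2 * L) := by ring
    rw [e, abs_mul]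
    refine mul_le_mul hO ?_ (abs_nonneg _) (by positivity)
    calc |O - L + 2 * L| ≤ |O - L| + |2 * L| := abs_add_le _ _
      _ ≤ 72 * m ^ 3 + 2 * (96 * m) := by rw [abs_mul, abs_two]; exact add_le_add hO (by linarith)
      _ = 2 * (96 * m) + 72 * m ^ 3 := by ring
  have hm3 : m ^ 3 ≤ m := by
    calc m ^ 3 = m * (m * m) := by ring
      _ ≤ m * (1 * 1) := mul_le_mul_of_nonneg_left (mul_le_mul hm hm hm0 zero_le_one) hm0
      _ = m := by ring
  calc |E ^ 2 + O ^ 2 - L ^ 2| = |E ^ 2 + (O ^ 2 - L ^ 2)| := by ring_nf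
    _ ≤ |E ^ 2| + |O ^ 2 - L ^ 2| := abs_add_le _ _
    _ ≤ (160 * m ^ 2) ^ 2 + 72 * m ^ 3 * (2 * (96 * m) + 72 * m ^ 3) := add_le_add h1 h2
    _ = 39424 * m ^ 4 + 5184 * m ^ 6 := by ring
    _ ≤ 39424 * m ^ 4 + 5184 * m ^ 4 := by
        have hm64 : m ^ 6 ≤ m ^ 4 := by
          calc m ^ 6 = m ^ 4 * (m * m) := by ring
            _ ≤ m ^ 4 * (1 * 1) := mul_le_mul_of_nonneg_left (mul_le_mul hm hm hm0 zero_le_one) (pow_nonneg hm0 4)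
            _ = m ^ 4 := by ring
        linarith
    _ = 44608 * m ^ 4 := by ring

/-- **At a Landau representative**: the per-site, per-colour ODD term `|2·divEven·divOdd| ≤ 320·m²·(|divDefectLin| + 72m³)`. -/
theorem abs_two_mul_even_mul_odd_le (hL : divDefect U x = 0) (hx : ‖a x‖ ≤ m)
    (hnb : ∀ μ : Fin 4, ‖a (x - Pi.single μ 1)‖ ≤ m ∧ ‖a (x + Pi.single μ 1)‖ ≤ m) (hm : m ≤ 1) (c : Fin 3) :
    |2 * (divEven U a x c * divOdd U a x c)| ≤ 320 * m ^ 2 * (|divDefectLin U a x c| + 72 * m ^ 3) := by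
  have hE := abs_divEven_sub_divDefect_le (U := U) hx hnb c
  rw [hL, Pi.zero_apply, sub_zero] at hE
  have hO := abs_divOdd_sub_divDefectLin_le (U := U) hx hnb hm c
  have hO' : |divOdd U a x c| ≤ |divDefectLin U a x c| + 72 * m ^ 3 := by
    have := abs_sub_abs_le_abs_sub (divOdd U a x c) (divDefectLin U a x c)
    linarith
  rw [abs_mul, abs_mul, abs_two]
  calc 2 * (|divEven U a x c| * |divOdd U a x c|) ≤ 2 * ((160 * m ^ 2) * (|divDefectLin U a x c| + 72 * m ^ 3)) := by
        refine mul_le_mul_of_nonneg_left (mul_le_mul hE hO' (abs_nonneg _) (by positivity)) (by norm_num)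
    _ = 320 * m ^ 2 * (|divDefectLin U a x c| + 72 * m ^ 3) := by ring

end SiteBounds

/-! ## The split of `landauPhi` along the orbit -/

/-- EVEN part of `landauPhi H (U^{exp ia})`: `Σ_{x interior} Σ_c (divEven² + divOdd²)`. [problem-side definition] -/
def phiEven (H : ℕ) (U : LGConfig 4 SU2) (a : Site 4 → EuclideanSpace ℝ (Fin 3)) : ℝ :=
  ∑ x ∈ interiorSites H, ∑ c : Fin 3, (divEven U a x c ^ 2 + divOdd U a x c ^ 2)

/-- ODD part of `landauPhi H (U^{exp ia})`: `Σ_{x interior} Σ_c 2·divEven·divOdd`. [problem-side definition] -/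
def phiOdd (H : ℕ) (U : LGConfig 4 SU2) (a : Site 4 → EuclideanSpace ℝ (Fin 3)) : ℝ :=
  ∑ x ∈ interiorSites H, ∑ c : Fin 3, 2 * (divEven U a x c * divOdd U a x c)

/-- ★ **`landauPhi H (U^{exp ia}) = phiEven + phiOdd`** (exact). -/
theorem landauPhi_gaugeTransformZd_eq (H : ℕ) (U : LGConfig 4 SU2) (a : Site 4 → EuclideanSpace ℝ (Fin 3)) :
    landauPhi H (gaugeTransformZd (fun z => expPauli (a z)) U) = phiEven H U a + phiOdd H U a := by
  unfold landauPhi phiEven phiOdd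
  rw [← Finset.sum_add_distrib]
  refine Finset.sum_congr rfl fun x _ => ?_
  rw [← Finset.sum_add_distrib]
  refine Finset.sum_congr rfl fun c _ => ?_
  rw [divDefect_gaugeTransformZd_eq, Pi.add_apply]
  ring

/-- ★ `phiEven` is EVEN in the field. -/
theorem phiEven_neg (H : ℕ) (U : LGConfig 4 SU2) (a : Site 4 → EuclideanSpace ℝ (Fin 3)) : phiEven H U (-a) = phiEven H U a := by
  simp only [phiEven, divEven_neg, divOdd_neg, Pi.neg_apply, neg_sq]

/-- ★ `phiOdd` is ODD in the field. -/
theorem phiOdd_neg (H : ℕ) (U : LGConfig 4 SU2) (a : Site 4 → EuclideanSpace ℝ (Fin 3)) : phiOdd H U (-a) = -phiOdd H U a := by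
  simp only [phiOdd, divEven_neg, divOdd_neg, Pi.neg_apply, mul_neg, ← Finset.sum_neg_distrib]

/-- ★★ **EVEN ERROR at a Landau representative, per site**: with `m x` dominating `|a|` on `x, x ± e_μ` (`m x ≤ 1`) for every interior `x`,
`|phiEven − Σ_x Σ_c divDefectLin²| ≤ Σ_x 133824·(m x)⁴`. -/
theorem abs_phiEven_sub_sum_lin_sq_le (H : ℕ) (U : LGConfig 4 SU2) (a : Site 4 → EuclideanSpace ℝ (Fin 3)) (m : Site 4 → ℝ)
    (hL : ∀ x ∈ interiorSites H, divDefect U x = 0)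
    (hm : ∀ x ∈ interiorSites H, ‖a x‖ ≤ m x ∧ (∀ μ : Fin 4, ‖a (x - Pi.single μ 1)‖ ≤ m x ∧ ‖a (x + Pi.single μ 1)‖ ≤ m x) ∧ m x ≤ 1) :
    |phiEven H U a - ∑ x ∈ interiorSites H, ∑ c : Fin 3, divDefectLin U a x c ^ 2|
      ≤ ∑ x ∈ interiorSites H, 133824 * m x ^ 4 := by
  unfold phiEven
  rw [← Finset.sum_sub_distrib]
  refine (Finset.abs_sum_le_sum_abs _ _).trans (Finset.sum_le_sum fun x hx => ?_)
  obtain ⟨h1, h2, h3⟩ := hm x hx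
  rw [← Finset.sum_sub_distrib]
  refine (Finset.abs_sum_le_sum_abs _ _).trans ?_
  calc ∑ c : Fin 3, |divEven U a x c ^ 2 + divOdd U a x c ^ 2 - divDefectLin U a x c ^ 2|
      ≤ ∑ _c : Fin 3, 44608 * m x ^ 4 := Finset.sum_le_sum fun c _ => abs_even_sq_add_odd_sq_sub_lin_sq_le (hL x hx) h1 h2 h3 c
    _ = 133824 * m x ^ 4 := by simp; ring

/-- ★★ **ODD SIZE at a Landau representative, per site**: `|phiOdd| ≤ Σ_x Σ_c 320·(m x)²·(|divDefectLin U a x c| + 72·(m x)³)`. -/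
theorem abs_phiOdd_le (H : ℕ) (U : LGConfig 4 SU2) (a : Site 4 → EuclideanSpace ℝ (Fin 3)) (m : Site 4 → ℝ)
    (hL : ∀ x ∈ interiorSites H, divDefect U x = 0)
    (hm : ∀ x ∈ interiorSites H, ‖a x‖ ≤ m x ∧ (∀ μ : Fin 4, ‖a (x - Pi.single μ 1)‖ ≤ m x ∧ ‖a (x + Pi.single μ 1)‖ ≤ m x) ∧ m x ≤ 1) :
    |phiOdd H U a| ≤ ∑ x ∈ interiorSites H, ∑ c : Fin 3, 320 * m x ^ 2 * (|divDefectLin U a x c| + 72 * m x ^ 3) := by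
  unfold phiOdd
  refine (Finset.abs_sum_le_sum_abs _ _).trans (Finset.sum_le_sum fun x hx => ?_)
  obtain ⟨h1, h2, h3⟩ := hm x hx
  exact (Finset.abs_sum_le_sum_abs _ _).trans (Finset.sum_le_sum fun c _ => abs_two_mul_even_mul_odd_le (hL x hx) h1 h2 h3 c)

/-- ★ The same with the linear term eliminated (`|divDefectLin| ≤ 96 m`): `|phiOdd| ≤ Σ_x 161280·(m x)³` — the cubic size that makes
`T := β·phiOdd` an admissible odd perturbation for ✓`oddPerturbationBounds` (4h). -/
theorem abs_phiOdd_le_cubic (H : ℕ) (U : LGConfig 4 SU2) (a : Site 4 → EuclideanSpace ℝ (Fin 3)) (m : Site 4 → ℝ)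
    (hL : ∀ x ∈ interiorSites H, divDefect U x = 0)
    (hm : ∀ x ∈ interiorSites H, ‖a x‖ ≤ m x ∧ (∀ μ : Fin 4, ‖a (x - Pi.single μ 1)‖ ≤ m x ∧ ‖a (x + Pi.single μ 1)‖ ≤ m x) ∧ m x ≤ 1) :
    |phiOdd H U a| ≤ ∑ x ∈ interiorSites H, 161280 * m x ^ 3 := by
  refine (abs_phiOdd_le H U a m hL hm).trans (Finset.sum_le_sum fun x hx => ?_)
  obtain ⟨h1, h2, h3⟩ := hm x hx
  have hm0 : 0 ≤ m x := (norm_nonneg _).trans h1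
  have hm3 : m x ^ 3 ≤ m x := by
    calc m x ^ 3 = m x * (m x * m x) := by ring
      _ ≤ m x * (1 * 1) := mul_le_mul_of_nonneg_left (mul_le_mul h3 h3 hm0 zero_le_one) hm0
      _ = m x := by ring
  calc ∑ c : Fin 3, 320 * m x ^ 2 * (|divDefectLin U a x c| + 72 * m x ^ 3)
      ≤ ∑ _c : Fin 3, 320 * m x ^ 2 * (96 * m x + 72 * m x) := Finset.sum_le_sum fun c _ => by
        refine mul_le_mul_of_nonneg_left (add_le_add (abs_divDefectLin_le h1 h2 c) (by linarith)) (by positivity)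
    _ = 161280 * m x ^ 3 := by simp; ring

/-! ## The interior Pauli field: `a = extPauli H A`, the transformation `pauliGauge`, the operator `fpOperator` -/

/-- For interior Pauli coordinates the linear term is the Faddeev–Popov operator: on the interior,
`divDefectLin U (extPauli H (vecToField H v)) x c = (fpOperator H U *ᵥ v) (x, c)` (✓`fpOperator_mulVec`). -/
theorem sum_lin_sq_eq_dotProduct (H : ℕ) (U : LGConfig 4 SU2) (v : ↥(interiorSites H) × Fin 3 → ℝ) :
    ∑ x ∈ interiorSites H, ∑ c : Fin 3, divDefectLin U (extPauli H (vecToField H v)) x c ^ 2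
      = (fpOperator H U *ᵥ v) ⬝ᵥ (fpOperator H U *ᵥ v) := by
  rw [dotProduct, Fintype.sum_prod_type, ← Finset.sum_coe_sort (interiorSites H)]
  refine Finset.sum_congr rfl fun x _ => Finset.sum_congr rfl fun c _ => ?_
  rw [fpOperator_mulVec, sq]

/-- ★★★ **THE PARITY EXPANSION OF `landauPhi` ALONG THE INTERIOR ORBIT at a Landau representative** (the form the Laplace assembly
consumes): for `v : interiorSites × Fin 3 → ℝ`, `a = extPauli H (vecToField H v)` and the interior transformation `exp ia`
(= `pauliGauge` of T-S5.4b, ✓`extendGauge_expPauli`),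
`landauPhi H (U^{exp ia}) = phiEven + phiOdd`, `phiEven` even, `phiOdd` odd, and per site
`|phiEven − ‖fpOperator H U *ᵥ v‖²| ≤ Σ_x 133824·(m x)⁴`, `|phiOdd| ≤ Σ_x 161280·(m x)³`. -/
theorem landauPhi_orbit_parity (H : ℕ) (U : LGConfig 4 SU2) (hL : ∀ x ∈ interiorSites H, divDefect U x = 0)
    (v : ↥(interiorSites H) × Fin 3 → ℝ) (m : Site 4 → ℝ)
    (hm : ∀ x ∈ interiorSites H, ‖extPauli H (vecToField H v) x‖ ≤ m x ∧
      (∀ μ : Fin 4, ‖extPauli H (vecToField H v) (x - Pi.single μ 1)‖ ≤ m x ∧ ‖extPauli H (vecToField H v) (x + Pi.single μ 1)‖ ≤ m x) ∧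
      m x ≤ 1) :
    landauPhi H (gaugeTransformZd (extendGauge H fun y => expPauli (vecToField H v y)) U)
        = phiEven H U (extPauli H (vecToField H v)) + phiOdd H U (extPauli H (vecToField H v)) ∧
      |phiEven H U (extPauli H (vecToField H v)) - (fpOperator H U *ᵥ v) ⬝ᵥ (fpOperator H U *ᵥ v)|
        ≤ ∑ x ∈ interiorSites H, 133824 * m x ^ 4 ∧
      |phiOdd H U (extPauli H (vecToField H v))| ≤ ∑ x ∈ interiorSites H, 161280 * m x ^ 3 := by
  refine ⟨?_, ?_, abs_phiOdd_le_cubic H U _ m hL hm⟩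
  · rw [extendGauge_expPauli]
    exact landauPhi_gaugeTransformZd_eq H U _
  · rw [← sum_lin_sq_eq_dotProduct]
    exact abs_phiEven_sub_sum_lin_sq_le H U _ m hL hm

/-- `‖extPauli H A z‖ ≤ M` everywhere as soon as `‖A y‖ ≤ M` on the interior and `0 ≤ M`. -/
theorem norm_extPauli_le {H : ℕ} {A : ↥(interiorSites H) → EuclideanSpace ℝ (Fin 3)} {M : ℝ} (hM : 0 ≤ M)
    (hA : ∀ y, ‖A y‖ ≤ M) (z : Site 4) : ‖extPauli H A z‖ ≤ M := by
  by_cases hz : z ∈ interiorSites H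
  · rw [extPauli_of_mem A hz]; exact hA _
  · rw [extPauli_of_not_mem A hz, norm_zero]; exact hM

/-- ★★ **Sup-norm form** of `landauPhi_orbit_parity`: if every interior Pauli coordinate has length `≤ M ≤ 1`, then
`|phiEven − ‖fpOperator H U *ᵥ v‖²| ≤ |I|·133824·M⁴` and `|phiOdd| ≤ |I|·161280·M³` (`|I| = #interiorSites H`). -/
theorem landauPhi_orbit_parity_sup (H : ℕ) (U : LGConfig 4 SU2) (hL : ∀ x ∈ interiorSites H, divDefect U x = 0)
    (v : ↥(interiorSites H) × Fin 3 → ℝ) (M : ℝ) (hM0 : 0 ≤ M) (hM1 : M ≤ 1) (hv : ∀ y, ‖vecToField H v y‖ ≤ M) :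
    landauPhi H (gaugeTransformZd (extendGauge H fun y => expPauli (vecToField H v y)) U)
        = phiEven H U (extPauli H (vecToField H v)) + phiOdd H U (extPauli H (vecToField H v)) ∧
      |phiEven H U (extPauli H (vecToField H v)) - (fpOperator H U *ᵥ v) ⬝ᵥ (fpOperator H U *ᵥ v)|
        ≤ (interiorSites H).card * (133824 * M ^ 4) ∧
      |phiOdd H U (extPauli H (vecToField H v))| ≤ (interiorSites H).card * (161280 * M ^ 3) := by
  have hm : ∀ x ∈ interiorSites H, ‖extPauli H (vecToField H v) x‖ ≤ M ∧
      (∀ μ : Fin 4, ‖extPauli H (vecToField H v) (x - Pi.single μ 1)‖ ≤ M ∧ ‖extPauli H (vecToField H v) (x + Pi.single μ 1)‖ ≤ M) ∧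
      M ≤ 1 := fun x _ =>
    ⟨norm_extPauli_le hM0 hv _, fun μ => ⟨norm_extPauli_le hM0 hv _, norm_extPauli_le hM0 hv _⟩, hM1⟩
  obtain ⟨h1, h2, h3⟩ := landauPhi_orbit_parity H U hL v (fun _ => M) hm
  refine ⟨h1, h2.trans (le_of_eq ?_), h3.trans (le_of_eq ?_)⟩
  · rw [Finset.sum_const, nsmul_eq_mul]
  · rw [Finset.sum_const, nsmul_eq_mul]

end Parity

end Summit.QuantumFields.YangMills.Theorems.AllWindowsColdBoxBoxHighLine

end
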